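import Summits.BirchSwinnertonDyer.BirchSwinnertonDyer.Theorems.LeadingTermConsistencyBypass
import HarnessLib

/-!
# BirchSwinnertonDyer / LeadingTerm — crux `Consistency` (stmt-BirchSwinnertonDyer-16217):
# the EXACT two-child split `Consistency ↔ ConsistencyNonDeficient ∧ DeficientVanishing`

Strategist decomposition of crux #2 `Consistency` of route `LeadingTerm` along the ONE fault line that matters
for the route's deciding theorem — the sign of `r_an − r_MW` (typed and proved by the crux-strategist
`cstrat-stmt-BirchSwinnertonDyer-16217-s1`, 2026-08-17, `Cruxes/Consistency/Strategist_ConsistencySplit.lean`;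
landed by the redirect strategist `cstrat-stmt-BirchSwinnertonDyer-16217-r1`, 2026-08-28, as the `--glue-by`
theorem of the installed split; the child-A bookkeeping is the companion file
`LeadingTermConsistencySplitChildA`).

* Child **A = `ConsistencyNonDeficient`** — the crux restricted to the cells `r_an ≤ r_MW` (diagonal and
  excess): the leading-term consistency proper. On the diagonal `r_an = r_MW` it is the `p`-adic Beilinson
  identity WITH ITS RATIONAL CONSTANT (`r = 0`: Mazur–Swinnerton-Dyer interpolation, tree theorem
  `leadingTerm_consistency_of_rank_zero`; `r = 1`: Perrin-Riou 1987, the support item `RankLeOne`;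
  `r ≥ 2`: the stub S2 of lines `Sketch`/`birth`/`ladder-rank2`, i.e. (R) BSD-rationality at the rank ∧ (T)
  the `p`-adic transfer given the constant — Burns–Kurihara–Sano, Conj. 1.1 / Cor. 1.10, OPEN); the excess
  cells `r_an < r_MW` are emptied by crux #4 `SqueezeUBR2`. Child A contains BSD-RATIONALITY in rank `≥ 2`
  (`rationality_of_nonDeficient`, companion file), which is NOT a consequence of the summit statement
  (BSD-rank): it is refined-BSD content (Tate 1974 Conj. 4(b) read modulo `ℚ^×`).
* Child **B = `DeficientVanishing`** — in every deficient cell `r_MW < r_an`, at every good ordinary `p ≥ 5`,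
  the `r_MW`-th Taylor coefficient of `L_p(f, α_p, T)` vanishes (`D`-free; the archimedean identity forces
  `q = 0` there). This is the ONLY part of the crux the deciding theorem `closes` consumes:
  `bsd_of_deficientVanishing_of_pinchPrime_of_squeezeUB : B → PinchPrime → SqueezeUBR2 → BirchSwinnertonDyer`
  (= the landed `bsd_of_pinchPrime_of_deficientVanishing`, p135377). Child B is WITHIN the summit
  (`deficientVanishing_of_bsd`: BSD-rank makes it vacuous) and is closed MODULO ITEMS
  (`deficientVanishing_of_katoCorankBound_of_selmerRankItems`: `KatoCorankBound` + route SelmerRank's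
  `SelmerRankLB` + `SelmerRankSmallImage`, = the landed `deficientVanishing_of_items`); unconditionally it is
  known in every cell except the matched-parity cells `(r_MW, r_an) = (r, r + 2k)`, `r ≥ 2`, `k ≥ 1`, where it
  is the rank-`r` `p`-converse (first open cell `(2,4)`).

The split is EXACT and item-free: `consistency_of_nonDeficient_of_deficientVanishing : A → B → Consistency`
(the `--glue-by` theorem; case split on `r_an ≤ r_MW`, deficient cells by `consistencyAt_of_coeff_eq_zero`),
`nonDeficient_of_consistency`, `deficientVanishing_of_consistency` (restriction; a canonical datum exists by
`exists_isCanonical_holds`, `log_p γ ≠ 0` by `leadingTerm_padicLog_cyclotomicGenerator_ne_zero`), and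
`consistency_iff_nonDeficient_and_deficientVanishing`. Nothing is asserted about any item or child; all
enter as explicit hypotheses, spelled out verbatim (the children are installed as route decls by the split).

References: Mazur–Tate–Teitelbaum, Invent. Math. 84 (1986) §I.14, §II.10; Perrin-Riou, Invent. Math. 89
(1987) §1.4; Kato, Astérisque 295 (2004) Thm 18.4; Burns–Kurihara–Sano (BurnsKuriharaSano2019) Conj. 1.1,
Cor. 1.10; BurnsKuriharaSano2021 p. 2.
-/

set_option linter.dupNamespace false

namespace Summit.BirchSwinnertonDyer.BirchSwinnertonDyer.Theorems

open scoped MatrixGroups ModularForm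
open CongruenceSubgroup Literature.NumberTheory.EllipticCurves
  Literature.NumberTheory.EllipticCurves.ModularForms WeierstrassCurve
open Summit.BirchSwinnertonDyer.BirchSwinnertonDyer.Theses.LeadingTerm (Consistency PinchPrime SqueezeUBR2
  RankLeOne KatoCorankBound)
open Summit.BirchSwinnertonDyer.BirchSwinnertonDyer.Theses.SelmerRank (SelmerRankLB SelmerRankSmallImage)

/-! ### The glue: children → crux (the `--glue-by` theorem) -/

/-- **`Consistency` from its two children** — (A) `ConsistencyNonDeficient` (the crux on the cells
`r_an ≤ r_MW`) and (B) `DeficientVanishing` (`r_MW < r_an ⇒ [T^{r_MW}]L_p(f,α_p,T) = 0`): case split on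
`r_an ≤ r_MW`; in a deficient cell both identities hold with `q = 0` (`consistencyAt_of_coeff_eq_zero`:
`L^{(r_MW)}(E,1) = 0` below the analytic order, `Reg_∞ > 0`, `Ω⁺_f > 0` tree theorems). Colon form,
children spelled out verbatim. [folklore] -/
theorem consistency_of_nonDeficient_of_deficientVanishing :
    (∀ (W : WeierstrassCurve ℚ) [W.IsElliptic] [W.IsGloballyMinimal] (p : ℕ) [Fact p.Prime],
      5 ≤ p → Literature.NumberTheory.EllipticCurves.IsOrdinaryAt W p →
      ∀ (D : WeierstrassCurve.PAdicHeightData W p), D.IsCanonical →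
      ∀ ⦃N : ℕ⦄ [NeZero N] (f : CuspForm (CongruenceSubgroup.Gamma0 N) 2),
        Literature.NumberTheory.EllipticCurves.ModularForms.IsNewformOf W f →
        W.analyticRank ≤ W.mordellWeilRank →
          0 < W.regulator ∧ 0 < Literature.NumberTheory.EllipticCurves.ModularForms.plusPeriod f ∧
          ∃ q : ℚ, iteratedDeriv W.mordellWeilRank W.entireLFunction 1 =
              (((W.mordellWeilRank.factorial : ℝ) * (q : ℝ) *
                Literature.NumberTheory.EllipticCurves.ModularForms.plusPeriod f * W.regulator : ℝ) : ℂ) ∧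
            PowerSeries.coeff W.mordellWeilRank
                (Literature.NumberTheory.EllipticCurves.padicLFunction f
                  (Literature.NumberTheory.EllipticCurves.unitRoot W p : ℚ_[p])) *
                Literature.NumberTheory.EllipticCurves.padicLog p
                  (Literature.NumberTheory.EllipticCurves.cyclotomicGenerator p) ^ W.mordellWeilRank =
              (q : ℚ_[p]) * (1 - (Literature.NumberTheory.EllipticCurves.unitRoot W p : ℚ_[p])⁻¹) ^ 2 *
                WeierstrassCurve.padicRegulator D) →
    (∀ (W : WeierstrassCurve ℚ) [W.IsElliptic] [W.IsGloballyMinimal] (p : ℕ) [Fact p.Prime],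
      5 ≤ p → Literature.NumberTheory.EllipticCurves.IsOrdinaryAt W p →
      ∀ ⦃N : ℕ⦄ [NeZero N] (f : CuspForm (CongruenceSubgroup.Gamma0 N) 2),
        Literature.NumberTheory.EllipticCurves.ModularForms.IsNewformOf W f →
        W.mordellWeilRank < W.analyticRank →
          PowerSeries.coeff W.mordellWeilRank
            (Literature.NumberTheory.EllipticCurves.padicLFunction f
              (Literature.NumberTheory.EllipticCurves.unitRoot W p : ℚ_[p])) = 0) →
    Summit.BirchSwinnertonDyer.BirchSwinnertonDyer.Theses.LeadingTerm.Consistency := by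
  intro hA hB W _ _ p _ h5 hord D hD N _ f hf
  rcases le_or_gt W.analyticRank W.mordellWeilRank with hle | hlt
  · exact hA W p h5 hord D hD f hf hle
  · exact consistencyAt_of_coeff_eq_zero W p D f hf hlt (hB W p h5 hord f hf hlt)

/-! ### No child is stronger than the crux: both are restrictions -/

/-- **`Consistency → ConsistencyNonDeficient`** (restriction to the cells `r_an ≤ r_MW`). [folklore] -/
theorem nonDeficient_of_consistency :
    Summit.BirchSwinnertonDyer.BirchSwinnertonDyer.Theses.LeadingTerm.Consistency →
    ∀ (W : WeierstrassCurve ℚ) [W.IsElliptic] [W.IsGloballyMinimal] (p : ℕ) [Fact p.Prime],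
      5 ≤ p → Literature.NumberTheory.EllipticCurves.IsOrdinaryAt W p →
      ∀ (D : WeierstrassCurve.PAdicHeightData W p), D.IsCanonical →
      ∀ ⦃N : ℕ⦄ [NeZero N] (f : CuspForm (CongruenceSubgroup.Gamma0 N) 2),
        Literature.NumberTheory.EllipticCurves.ModularForms.IsNewformOf W f →
        W.analyticRank ≤ W.mordellWeilRank →
          0 < W.regulator ∧ 0 < Literature.NumberTheory.EllipticCurves.ModularForms.plusPeriod f ∧
          ∃ q : ℚ, iteratedDeriv W.mordellWeilRank W.entireLFunction 1 =
              (((W.mordellWeilRank.factorial : ℝ) * (q : ℝ) *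
                Literature.NumberTheory.EllipticCurves.ModularForms.plusPeriod f * W.regulator : ℝ) : ℂ) ∧
            PowerSeries.coeff W.mordellWeilRank
                (Literature.NumberTheory.EllipticCurves.padicLFunction f
                  (Literature.NumberTheory.EllipticCurves.unitRoot W p : ℚ_[p])) *
                Literature.NumberTheory.EllipticCurves.padicLog p
                  (Literature.NumberTheory.EllipticCurves.cyclotomicGenerator p) ^ W.mordellWeilRank =
              (q : ℚ_[p]) * (1 - (Literature.NumberTheory.EllipticCurves.unitRoot W p : ℚ_[p])⁻¹) ^ 2 *
                WeierstrassCurve.padicRegulator D :=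
  fun hC W _ _ p _ h5 hord D hD _ _ f hf _ => hC W p h5 hord D hD f hf

/-- **`Consistency → DeficientVanishing`**: in a deficient cell `r_MW < r_an` instantiate the crux at the
canonical datum (it exists: `exists_isCanonical_holds`, Mazur–Tate / Schneider σ-height); the archimedean
identity forces `q = 0` (`L^{(r_MW)}(E,1) = 0`, `r!·Ω⁺_f·Reg_∞ ≠ 0`), so `[T^{r_MW}]L_p · log_p(γ)^{r_MW} = 0`,
and `log_p γ ≠ 0` (`leadingTerm_padicLog_cyclotomicGenerator_ne_zero`). [folklore] -/
theorem deficientVanishing_of_consistency :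
    Summit.BirchSwinnertonDyer.BirchSwinnertonDyer.Theses.LeadingTerm.Consistency →
    ∀ (W : WeierstrassCurve ℚ) [W.IsElliptic] [W.IsGloballyMinimal] (p : ℕ) [Fact p.Prime],
      5 ≤ p → Literature.NumberTheory.EllipticCurves.IsOrdinaryAt W p →
      ∀ ⦃N : ℕ⦄ [NeZero N] (f : CuspForm (CongruenceSubgroup.Gamma0 N) 2),
        Literature.NumberTheory.EllipticCurves.ModularForms.IsNewformOf W f →
        W.mordellWeilRank < W.analyticRank →
          PowerSeries.coeff W.mordellWeilRank
            (Literature.NumberTheory.EllipticCurves.padicLFunction f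
              (Literature.NumberTheory.EllipticCurves.unitRoot W p : ℚ_[p])) = 0 := by
  intro hC W _ _ p _ h5 hord N _ f hf hlt
  obtain ⟨D, hD⟩ := exists_isCanonical_holds W p h5 hord.1 hord.2
  obtain ⟨hreg, hΩ, q, hA, hP⟩ := hC W p h5 hord D hD f hf
  have hL : iteratedDeriv W.mordellWeilRank W.entireLFunction 1 = 0 :=
    iteratedDeriv_entireLFunction_eq_zero_of_lt_analyticRank W hlt
  have hq : q = 0 := by
    rw [hL] at hA
    have hfac : (0 : ℝ) < W.mordellWeilRank.factorial := by exact_mod_cast Nat.factorial_pos _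
    have h : ((W.mordellWeilRank.factorial : ℝ) * (q : ℝ) * plusPeriod f * W.regulator : ℝ) = 0 := by
      exact_mod_cast hA.symm
    have hne : (W.mordellWeilRank.factorial : ℝ) * plusPeriod f * W.regulator ≠ 0 :=
      mul_ne_zero (mul_ne_zero hfac.ne' hΩ.ne') hreg.ne'
    have : (q : ℝ) * ((W.mordellWeilRank.factorial : ℝ) * plusPeriod f * W.regulator) = 0 := by
      linear_combination h
    exact_mod_cast (mul_eq_zero.mp this).resolve_right hne
  subst hq
  have h0 : PowerSeries.coeff W.mordellWeilRank (padicLFunction f (unitRoot W p : ℚ_[p])) *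
      padicLog p (cyclotomicGenerator p) ^ W.mordellWeilRank = 0 := by
    rw [hP]; push_cast; ring
  exact (mul_eq_zero.mp h0).resolve_right
    (pow_ne_zero _ (leadingTerm_padicLog_cyclotomicGenerator_ne_zero p))

/-- **The split is EXACT**: `Consistency ↔ ConsistencyNonDeficient ∧ DeficientVanishing`, with no item as
hypothesis. [folklore] -/
theorem consistency_iff_nonDeficient_and_deficientVanishing :
    Summit.BirchSwinnertonDyer.BirchSwinnertonDyer.Theses.LeadingTerm.Consistency ↔
    ((∀ (W : WeierstrassCurve ℚ) [W.IsElliptic] [W.IsGloballyMinimal] (p : ℕ) [Fact p.Prime],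
      5 ≤ p → Literature.NumberTheory.EllipticCurves.IsOrdinaryAt W p →
      ∀ (D : WeierstrassCurve.PAdicHeightData W p), D.IsCanonical →
      ∀ ⦃N : ℕ⦄ [NeZero N] (f : CuspForm (CongruenceSubgroup.Gamma0 N) 2),
        Literature.NumberTheory.EllipticCurves.ModularForms.IsNewformOf W f →
        W.analyticRank ≤ W.mordellWeilRank →
          0 < W.regulator ∧ 0 < Literature.NumberTheory.EllipticCurves.ModularForms.plusPeriod f ∧
          ∃ q : ℚ, iteratedDeriv W.mordellWeilRank W.entireLFunction 1 =
              (((W.mordellWeilRank.factorial : ℝ) * (q : ℝ) *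
                Literature.NumberTheory.EllipticCurves.ModularForms.plusPeriod f * W.regulator : ℝ) : ℂ) ∧
            PowerSeries.coeff W.mordellWeilRank
                (Literature.NumberTheory.EllipticCurves.padicLFunction f
                  (Literature.NumberTheory.EllipticCurves.unitRoot W p : ℚ_[p])) *
                Literature.NumberTheory.EllipticCurves.padicLog p
                  (Literature.NumberTheory.EllipticCurves.cyclotomicGenerator p) ^ W.mordellWeilRank =
              (q : ℚ_[p]) * (1 - (Literature.NumberTheory.EllipticCurves.unitRoot W p : ℚ_[p])⁻¹) ^ 2 *
                WeierstrassCurve.padicRegulator D) ∧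
     (∀ (W : WeierstrassCurve ℚ) [W.IsElliptic] [W.IsGloballyMinimal] (p : ℕ) [Fact p.Prime],
      5 ≤ p → Literature.NumberTheory.EllipticCurves.IsOrdinaryAt W p →
      ∀ ⦃N : ℕ⦄ [NeZero N] (f : CuspForm (CongruenceSubgroup.Gamma0 N) 2),
        Literature.NumberTheory.EllipticCurves.ModularForms.IsNewformOf W f →
        W.mordellWeilRank < W.analyticRank →
          PowerSeries.coeff W.mordellWeilRank
            (Literature.NumberTheory.EllipticCurves.padicLFunction f
              (Literature.NumberTheory.EllipticCurves.unitRoot W p : ℚ_[p])) = 0)) :=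
  ⟨fun hC => ⟨nonDeficient_of_consistency hC, deficientVanishing_of_consistency hC⟩,
    fun h => consistency_of_nonDeficient_of_deficientVanishing h.1 h.2⟩

/-! ### Child B is the load-bearing, within-summit piece -/

/-- **The deciding theorem re-glued on child B**: `DeficientVanishing → PinchPrime → SqueezeUBR2 →
BirchSwinnertonDyer` — the landed `bsd_of_pinchPrime_of_deficientVanishing` (p135377) with child B's exact
spelling; a tenure `--closes-file` can take `closes (hDV : DeficientVanishing) (hP : PinchPrime)
(hUB : SqueezeUBR2) := Theorems.bsd_of_deficientVanishing_of_pinchPrime_of_squeezeUB hDV hP hUB`. [folklore] -/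
theorem bsd_of_deficientVanishing_of_pinchPrime_of_squeezeUB :
    (∀ (W : WeierstrassCurve ℚ) [W.IsElliptic] [W.IsGloballyMinimal] (p : ℕ) [Fact p.Prime],
      5 ≤ p → Literature.NumberTheory.EllipticCurves.IsOrdinaryAt W p →
      ∀ ⦃N : ℕ⦄ [NeZero N] (f : CuspForm (CongruenceSubgroup.Gamma0 N) 2),
        Literature.NumberTheory.EllipticCurves.ModularForms.IsNewformOf W f →
        W.mordellWeilRank < W.analyticRank →
          PowerSeries.coeff W.mordellWeilRank
            (Literature.NumberTheory.EllipticCurves.padicLFunction f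
              (Literature.NumberTheory.EllipticCurves.unitRoot W p : ℚ_[p])) = 0) →
    Summit.BirchSwinnertonDyer.BirchSwinnertonDyer.Theses.LeadingTerm.PinchPrime →
    Summit.BirchSwinnertonDyer.BirchSwinnertonDyer.Theses.LeadingTerm.SqueezeUBR2 →
    _root_.BirchSwinnertonDyer :=
  fun hB hP hUB => bsd_of_pinchPrime_of_deficientVanishing hB hP hUB

/-- **Child B is WITHIN the summit**: BSD-rank makes every deficient cell empty, so `DeficientVanishing`
follows from `BirchSwinnertonDyer` (informational `S → B`; contrast child A, which contains BSD-rationality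
in rank `≥ 2`, not a consequence of BSD-rank). [folklore] -/
theorem deficientVanishing_of_bsd :
    _root_.BirchSwinnertonDyer →
    ∀ (W : WeierstrassCurve ℚ) [W.IsElliptic] [W.IsGloballyMinimal] (p : ℕ) [Fact p.Prime],
      5 ≤ p → Literature.NumberTheory.EllipticCurves.IsOrdinaryAt W p →
      ∀ ⦃N : ℕ⦄ [NeZero N] (f : CuspForm (CongruenceSubgroup.Gamma0 N) 2),
        Literature.NumberTheory.EllipticCurves.ModularForms.IsNewformOf W f →
        W.mordellWeilRank < W.analyticRank →
          PowerSeries.coeff W.mordellWeilRank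
            (Literature.NumberTheory.EllipticCurves.padicLFunction f
              (Literature.NumberTheory.EllipticCurves.unitRoot W p : ℚ_[p])) = 0 := by
  intro h W hW _ p _ _ _ N _ f _ hlt
  have h' : ∀ V : WeierstrassCurve ℚ, V.IsElliptic → V.analyticRank = V.mordellWeilRank := h
  have := h' W hW
  omega

/-- **Child B is closed MODULO ITEMS**: `KatoCorankBound` (support, stmt-18048: Kato Thm 18.4, corank
form) with route SelmerRank's `SelmerRankLB` (stmt-0131) and `SelmerRankSmallImage` (stmt-14418) give
`DeficientVanishing` (`r_MW < r_an ≤ corank Sel_{p^∞} ≤ ord_T L_p` for `r_MW ≥ 1`, interpolation for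
`r_MW = 0`; = the landed `deficientVanishing_of_items`). [cite: Kato2004Asterisque, Thm 18.4 (p. 281)] -/
theorem deficientVanishing_of_katoCorankBound_of_selmerRankItems :
    Summit.BirchSwinnertonDyer.BirchSwinnertonDyer.Theses.LeadingTerm.KatoCorankBound →
    Summit.BirchSwinnertonDyer.BirchSwinnertonDyer.Theses.SelmerRank.SelmerRankLB →
    Summit.BirchSwinnertonDyer.BirchSwinnertonDyer.Theses.SelmerRank.SelmerRankSmallImage →
    ∀ (W : WeierstrassCurve ℚ) [W.IsElliptic] [W.IsGloballyMinimal] (p : ℕ) [Fact p.Prime],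
      5 ≤ p → Literature.NumberTheory.EllipticCurves.IsOrdinaryAt W p →
      ∀ ⦃N : ℕ⦄ [NeZero N] (f : CuspForm (CongruenceSubgroup.Gamma0 N) 2),
        Literature.NumberTheory.EllipticCurves.ModularForms.IsNewformOf W f →
        W.mordellWeilRank < W.analyticRank →
          PowerSeries.coeff W.mordellWeilRank
            (Literature.NumberTheory.EllipticCurves.padicLFunction f
              (Literature.NumberTheory.EllipticCurves.unitRoot W p : ℚ_[p])) = 0 :=
  fun hKC hLB hSI => deficientVanishing_of_items hLB hSI hKC

end Summit.BirchSwinnertonDyer.BirchSwinnertonDyer.Theorems
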